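import Summits.QuantumFields.BalabanUV.Beta.GAN24.MonotoneShorted
import Literature.MathematicalPhysics.QuantumFieldTheory.Balaban1983to89.Beta.BlockEffectiveAction

/-!
# Beta / GAN24 / MonotoneTorusLandau — BAŁABAN'S OWN GAUGE-FIXED CONSTRAINED COVARIANCE `𝒞 = 𝒫G` ((1.107), tree def
# `Beta.FluctuationProjection.Cov`) IS A LEGITIMATE SLICE FOR EVERY TRANSVERSE OBSERVABLE: its Landau multiplier does no work at co-closed
# sources, its columns there are CRITICAL for the curl energy on the gauge-free constraint space `ker Q`, and its transverse two-point blocks —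
# in particular the plaquette block `∂·𝒞·∂ᴴ` — coincide with those of the CANONICAL constrained covariance `critCov (½∂ᴴ∂) Q` (no gauge fixing)
# (gan24-p4 gen 4; BINDER-OWNERS row G-an2-4 ∕ (CONV-C), ALTERNATIVE DISCHARGE «rate OR monotonicity»; NOT IN PRINT — our proof attempt)

HONEST FRAMING (page 1 of everything the β sub-cell writes): discharging `BetaPertH` makes Bałaban's UV stability UNCONDITIONAL — a
real constructive-QFT result; it is NOT the continuum limit and NOT the Clay problem.  HONEST DEPENDENCY (cell reorg 2026-08-19, verbatim):
«continuum YM on T⁴ ⇐ BetaPertH ∧ nine spine estimates (0/9 proved); BetaPertH ⇐ (D1) ∧ (D4) ∧ CAP+tail; G-an2-4 gates asym, D1 and NE2/3/4.»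
HONEST LABEL: «not in print; our proof attempt; alternative discharge of the G-an2-4 row (rate OR monotonicity)»; 0 wall binders instantiated.
ABSOLUTE RULE honoured: NOTHING is cited here as a fact.  The printed objects enter as TREE DEFINITIONS with their kernel theorems BY NAME
(an5's β-cell modules): `B5DeltaA169.DeltaA` ((1.69) `Δ_a = ½∂ᴴ∂ + ∂R∂ᴴ + a·Q*Q`, `DeltaA_eq_curl`), `calG = Δ_a⁻¹` (`DeltaA_mul_calG`),
`Beta.FluctuationProjection.Cov` ((1.107) `𝒞 = 𝒫G`, `Cov_eq`, `DeltaA_mul_Cov`, `QvOp_mul_Cov`, `R_div_Cov`, `Cov_conjTranspose`),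
`Beta.LandauMultiplierIdentities` (the (1.95) mechanism «RΔ⁻¹Q′* = 0»: `GradOp_adjoint_mul_DeltaA`, `GradOp_adjoint_mul_QvAdj`,
`PcT_eq_self_of_LapS_eq`, `PcT_one_sub_PcT_mulVec`, `sum_PcT_mulVec`), `B5DivOrth.sum_GradOp_adjoint`, `LandauMultiplierIdentities.CurlOp_mul_GradOp`;
gen 2∕3∕4 GAN24 modules `MonotoneCoarsen` (`IsCrit`, `isCrit_ker_of_kkt`), `MonotoneCritical` (`critCov`, `pairing_eq_critCov`), `MonotoneShorted`
(`readOut_quad`, `hermitian_ext_of_quad`).  [folklore] glue only.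

## WHY (road P4; `HOME/b2b-balaban-gan24-p4/SKELETON-P4.md` node P4-N4 ∕ R1, `gen2/LOEWNER-DIAG.md` (N1)∕(N2))
Road P4's Loewner statements hold for covariance columns that are CRITICAL for the (degenerate) curl energy on the gauge-FREE constraint space
`ker Q` — for a gauge-fixed KKT system this says «the gauge multiplier does no work on `ker Q`» (gen 2's analysis; an5's `McolSum_eq_zero` for
an2's `ℤ^{d+1}` system; asym1's `GaugeSliceLegitimacy`).  THIS FILE proves it for BAŁABAN'S OWN PRINTED GAUGE FIXING on the torus — the
δ-function weak-Landau condition `R∂*A = 0` of [B5] §§D–F with `R = I − P` the printed projection — and for its constrained one-shot covariance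
`𝒞 = 𝒫G` typed in the tree by the β cell: at every CO-CLOSED source `r` (`∂ᴴ r = 0`) the multiplier of the gauge rows vanishes, by the very
mechanism behind the printed (1.95) «R∂*GQ* = 0».  Consequently every TRANSVERSE two-point block of `𝒞` equals the canonical one, to which
gen 3∕4's monotonicity theorems apply; the gauge-VARIANT blocks (finding (N2) of gen 2's diagnostic: not monotone at the first steps) are
exactly where `𝒞` and `critCov` may differ.

## WHAT IS PROVED (every `d`, `n ≥ 1`, unit torus `Tor M`, `a > 0`; fine torus `T_η = Tor (fine n M)`)
* §1 **`R_div_G_mulVec_of_coclosed`**: `∂ᴴ r = 0 ⟹ R ∂ᴴ (G r) = 0` — the Landau multiplier `λ = R∂*G r` of a CO-CLOSED source vanishes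
  (same proof as the printed (1.95) `R∂*GQ*ω = 0`: apply `∂ᴴ` to `Δ_a A = r`, `curl∘grad = 0`, (1.55), then «RΔ⁻¹Q′* = 0»; v1.1 DOCFIX, conceded to
  the cross-read C-gan24leaf14-29: (1.95) is NOT «the case `r = Q*ω`» of §1 — the source `Q*ω` has divergence `∂ᴴQ*ω = n^d·Q′ᴴ∂₁ᴴω`, zero only for
  co-closed `ω`; §1 (`g = 0`) and (1.95) (`g = n^d·∂₁ᴴω`) are SIBLINGS under §4's `R_div_G_mulVec_of_div_eq`).
* §2 `Cov_mulVec_of_coclosed` (`𝒞 r = G r − GQ*(QGQ*)⁻¹QG r`), `DeltaA_Cov_mulVec_of_coclosed` (`Δ_a 𝒞 r = r − Q*ω`), `curlForm_Cov_mulVec`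
  (`(½∂ᴴ∂)(𝒞 r) = Δ_a(𝒞 r)` — the gauge and `a`-terms of (1.69) vanish on the columns of `𝒞`), and **`isCrit_Cov_of_coclosed`**:
  `IsCrit (½∂ᴴ∂) r (ker Q) (𝒞 r)` for every co-closed `r`.
* §3 **`transverse_block_Cov_eq_critCov`**: for every test matrix `T` with CO-CLOSED ROWS (`T·∂ = 0`),
  `T·𝒞·Tᴴ = T·critCov (½∂ᴴ∂) Q·Tᴴ`; in particular **`curl_block_Cov_eq_critCov : ∂·𝒞·∂ᴴ = ∂·critCov (½∂ᴴ∂) Q·∂ᴴ`** (`∂ = CurlOp`, `∂·grad = 0`):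
  the plaquette two-point function of Bałaban's gauge-fixed constrained fluctuation field IS the canonical one of road P4.
* §4 (v1.1, append-only) **`R_div_G_mulVec_of_div_eq`**: `∂ᴴ r = Q′ᴴ g ∧ Σ g = 0 ⟹ R ∂ᴴ (G r) = 0` — the COMMON GENERALISATION of §1 (`g = 0`) and of
  the printed (1.95) (`r = Q*ω`, `g = n^d·∂₁ᴴω`); `coclosed_curl_adjoint` (every curl-type source `∂_curlᴴu` is co-closed) and `isCrit_Cov_curl_adjoint`
  (the case of §2 the header advertises: the columns of `𝒞` at plaquette-supported sources are critical on `ker Q`).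
WHAT THIS IS NOT: nothing about the gauge-variant blocks of `𝒞`; no rate; torus, `U = 1`; NOT (CONV-C), NOT BetaPertH, NOT continuum, NOT Clay.
-/

noncomputable section

namespace Summit.QuantumFields.BalabanUV.Beta.GAN24.MonotoneTorusLandau

open Matrix
open scoped BigOperators ComplexOrder
open Literature.MathematicalPhysics.QuantumFieldTheory.Balaban1983to89
open Literature.MathematicalPhysics.QuantumFieldTheory.Balaban1983to89.B5Prop11Plancherel
open Literature.MathematicalPhysics.QuantumFieldTheory.Balaban1983to89.B5Action121
open Literature.MathematicalPhysics.QuantumFieldTheory.Balaban1983to89.B5Block118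
open Literature.MathematicalPhysics.QuantumFieldTheory.Balaban1983to89.B5LaplaceInverse
open Literature.MathematicalPhysics.QuantumFieldTheory.Balaban1983to89.B5Value126
open Literature.MathematicalPhysics.QuantumFieldTheory.Balaban1983to89.B5DeltaA169
open Literature.MathematicalPhysics.QuantumFieldTheory.Balaban1983to89.B5DivOrth
open Literature.MathematicalPhysics.QuantumFieldTheory.Balaban1983to89.Beta.LandauMultiplierIdentities
open Literature.MathematicalPhysics.QuantumFieldTheory.Balaban1983to89.Beta.FluctuationProjection
open Literature.MathematicalPhysics.QuantumFieldTheory.Balaban1983to89.Beta.BlockEffectiveAction (curlPart_posSemidef)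
open Summit.QuantumFields.BalabanUV.Beta.GAN24.MonotoneCoarsen (IsCrit conj_pairing isCrit_ker_of_kkt)
open Summit.QuantumFields.BalabanUV.Beta.GAN24.MonotoneCritical (critCov critCov_isHermitian pairing_eq_critCov)
open Summit.QuantumFields.BalabanUV.Beta.GAN24.MonotoneShorted (readOut_quad hermitian_ext_of_quad)

variable {d : ℕ} (n : ℕ) [NeZero n] (hn : 1 ≤ n) (M : Fin d → ℕ) [hM : ∀ μ, NeZero (M μ)] (a : ℝ) (ha : 0 < a)

/-! ## §1 The Landau multiplier of a co-closed source vanishes -/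

/-- **`∂ᴴ r = 0 ⟹ R ∂ᴴ (G r) = 0`**: the multiplier `λ = R∂*G r` of the gauge rows vanishes for every CO-CLOSED source — the mechanism of the
printed (1.95) «R∂*GQ* = 0» (`LandauMultiplierIdentities`): apply `∂ᴴ` to `Δ_a A = r` (`A = G r`); `curl ∘ grad = 0` and (1.55) turn it into
`Δ_s(R∂ᴴA) = Q′ᴴ g` with `g ⊥ 1`, so `R∂ᴴA` lies in `range P ∩ range R = 0`. [folklore] -/
theorem R_div_G_mulVec_of_coclosed (r : Tor (fine n M) × Fin d → ℂ) (hr : (GradOp (fine n M) (n : ℂ))ᴴ *ᵥ r = 0) :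
    (1 - PcT n M (n : ℂ)) *ᵥ ((GradOp (fine n M) (n : ℂ))ᴴ *ᵥ (calG n hn M a ha *ᵥ r)) = 0 := by
  obtain ⟨A, hA⟩ : ∃ A, A = calG n hn M a ha *ᵥ r := ⟨_, rfl⟩
  rw [← hA]
  have hDA : DeltaA n M a *ᵥ A = r := by
    rw [hA, Matrix.mulVec_mulVec, DeltaA_mul_calG n hn M a ha, Matrix.one_mulVec]
  obtain ⟨u, hu⟩ : ∃ u, u = (1 - PcT n M (n : ℂ)) *ᵥ ((GradOp (fine n M) (n : ℂ))ᴴ *ᵥ A) := ⟨_, rfl⟩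
  rw [← hu]
  -- (i) `u ⊥ 1`
  have hu0 : ∑ x, u x = 0 := by
    rw [hu]
    simp only [Matrix.sub_mulVec, Matrix.one_mulVec, Pi.sub_apply, Finset.sum_sub_distrib, sum_GradOp_adjoint, sum_PcT_mulVec,
      sub_zero]
  -- (ii) `∂ᴴ Δ_a A = ∂ᴴ r = 0`, expanded with `∂ᴴΔ_a = Δ_s R ∂ᴴ + a ∂ᴴQ*Q` and `∂ᴴQ* = n^d Q′ᴴ∂₁ᴴ`
  have key : ((GradOp (fine n M) (n : ℂ))ᴴ * DeltaA n M a) *ᵥ A = 0 := by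
    rw [← Matrix.mulVec_mulVec, hDA, hr]
  rw [GradOp_adjoint_mul_DeltaA n M a, GradOp_adjoint_mul_QvAdj] at key
  simp only [Matrix.add_mulVec, Matrix.smul_mulVec, Matrix.smul_mul, ← Matrix.mulVec_mulVec] at key
  -- key : Δ_s(R∂ᴴA) + a • n^d • Q′ᴴ(∂₁ᴴ(QA)) = 0
  have hL : LapS (fine n M) (n : ℂ) *ᵥ u
      = (QsOp n M)ᴴ *ᵥ ((GradOp M 1)ᴴ *ᵥ (-((a : ℂ) • (((n : ℂ) ^ d) • (QvOp n M *ᵥ A))))) := by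
    rw [hu]
    simp only [Matrix.mulVec_neg, Matrix.mulVec_smul]
    exact eq_neg_of_add_eq_zero_left key
  have hg : ∑ y, ((GradOp M 1)ᴴ *ᵥ (-((a : ℂ) • (((n : ℂ) ^ d) • (QvOp n M *ᵥ A))))) y = 0 := sum_GradOp_adjoint M 1 _
  -- (iii) `P u = u`; (iv) `P u = P(1 − P)(∂ᴴA) = 0`
  have hP := PcT_eq_self_of_LapS_eq n M u _ hu0 hg hL
  have hP0 : PcT n M (n : ℂ) *ᵥ u = 0 := by rw [hu, PcT_one_sub_PcT_mulVec]
  rw [← hP, hP0]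

/-! ## §2 The columns of `𝒞` at co-closed sources: KKT without the gauge multiplier, criticality on `ker Q` -/

/-- The curl energy form `½∂ᴴ∂` on the fine torus (the gauge- and `a`-free part of (1.69)). [folklore] -/
abbrev curlForm : Matrix (Tor (fine n M) × Fin d) (Tor (fine n M) × Fin d) ℂ :=
  (1 / 2 : ℂ) • ((CurlOp (fine n M) (n : ℂ))ᴴ * CurlOp (fine n M) (n : ℂ))

/-- `½∂ᴴ∂` is positive semidefinite (tree `BlockEffectiveAction.curlPart_posSemidef`). [folklore] -/
theorem curlForm_posSemidef : (curlForm n M).PosSemidef := curlPart_posSemidef n M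

/-- `½∂ᴴ∂` is Hermitian. [folklore] -/
theorem curlForm_isHermitian : (curlForm n M).IsHermitian := (curlForm_posSemidef n M).isHermitian

/-- **`𝒞 r = G r − GQ*(QGQ*)⁻¹QG r` at a co-closed source** (the `G∂R∂ᴴG` term of `Cov_eq` drops by §1). [folklore] -/
theorem Cov_mulVec_of_coclosed (r : Tor (fine n M) × Fin d → ℂ) (hr : (GradOp (fine n M) (n : ℂ))ᴴ *ᵥ r = 0) :
    Cov n hn M a ha *ᵥ r
      = calG n hn M a ha *ᵥ r
        - calG n hn M a ha *ᵥ (QvAdj n M *ᵥ ((QGQ n hn M a ha)⁻¹ *ᵥ (QvOp n M *ᵥ (calG n hn M a ha *ᵥ r)))) := by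
  rw [Cov_eq, Matrix.sub_mulVec, Matrix.sub_mulVec]
  simp only [← Matrix.mulVec_mulVec]
  rw [R_div_G_mulVec_of_coclosed n hn M a ha r hr, Matrix.mulVec_zero, Matrix.mulVec_zero, sub_zero]

/-- **`Δ_a(𝒞 r) = r − Q*ω` at a co-closed source**, `ω = (QGQ*)⁻¹QG r` — the KKT identity of `𝒞` WITHOUT the gauge multiplier. [folklore] -/
theorem DeltaA_Cov_mulVec_of_coclosed (r : Tor (fine n M) × Fin d → ℂ) (hr : (GradOp (fine n M) (n : ℂ))ᴴ *ᵥ r = 0) :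
    DeltaA n M a *ᵥ (Cov n hn M a ha *ᵥ r)
      = r - QvAdj n M *ᵥ ((QGQ n hn M a ha)⁻¹ *ᵥ (QvOp n M *ᵥ (calG n hn M a ha *ᵥ r))) := by
  rw [Matrix.mulVec_mulVec, DeltaA_mul_Cov, Matrix.sub_mulVec, Matrix.sub_mulVec, Matrix.one_mulVec]
  simp only [← Matrix.mulVec_mulVec]
  rw [R_div_G_mulVec_of_coclosed n hn M a ha r hr, Matrix.mulVec_zero, sub_zero]

/-- **On the columns of `𝒞` the form (1.69) reduces to the curl energy**: `(½∂ᴴ∂)(𝒞 x) = Δ_a(𝒞 x)` for EVERY `x` (the gauge term vanishes by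
`R∂ᴴ𝒞 = 0`, the `a`-term by `Q𝒞 = 0`). [folklore] -/
theorem curlForm_Cov_mulVec (x : Tor (fine n M) × Fin d → ℂ) :
    curlForm n M *ᵥ (Cov n hn M a ha *ᵥ x) = DeltaA n M a *ᵥ (Cov n hn M a ha *ᵥ x) := by
  have hQ : QvOp n M *ᵥ (Cov n hn M a ha *ᵥ x) = 0 := by
    rw [Matrix.mulVec_mulVec, QvOp_mul_Cov, Matrix.zero_mulVec]
  have hR : (1 - PcT n M (n : ℂ)) *ᵥ ((GradOp (fine n M) (n : ℂ))ᴴ *ᵥ (Cov n hn M a ha *ᵥ x)) = 0 := by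
    rw [Matrix.mulVec_mulVec, Matrix.mulVec_mulVec, R_div_Cov, Matrix.zero_mulVec]
  rw [DeltaA_eq_curl n M a]
  simp only [Matrix.add_mulVec, Matrix.smul_mulVec, ← Matrix.mulVec_mulVec]
  rw [hR, hQ, Matrix.mulVec_zero, Matrix.mulVec_zero, smul_zero, add_zero, add_zero]

/-- **THE COLUMNS OF BAŁABAN'S `𝒞` AT CO-CLOSED SOURCES ARE CRITICAL** for the curl energy `½∂ᴴ∂` on the gauge-FREE constraint space `ker Q`:
`∂ᴴ r = 0 ⟹ IsCrit (½∂ᴴ∂) r (ker Q) (𝒞 r)` — the printed weak-Landau gauge fixing `R∂*A = 0` is a LEGITIMATE SLICE for every transverse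
observable. [folklore] -/
theorem isCrit_Cov_of_coclosed (r : Tor (fine n M) × Fin d → ℂ) (hr : (GradOp (fine n M) (n : ℂ))ᴴ *ᵥ r = 0) :
    IsCrit (curlForm n M) r (LinearMap.ker (QvOp n M).mulVecLin) (Cov n hn M a ha *ᵥ r) := by
  have hQ : QvOp n M *ᵥ (Cov n hn M a ha *ᵥ r) = 0 := by
    rw [Matrix.mulVec_mulVec, QvOp_mul_Cov, Matrix.zero_mulVec]
  refine isCrit_ker_of_kkt hQ (lam := -(((n : ℂ) ^ d) • ((QGQ n hn M a ha)⁻¹ *ᵥ (QvOp n M *ᵥ (calG n hn M a ha *ᵥ r))))) ?_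
  rw [curlForm_Cov_mulVec, DeltaA_Cov_mulVec_of_coclosed n hn M a ha r hr, QvAdj, Matrix.smul_mulVec, Matrix.mulVec_neg,
    Matrix.mulVec_smul]
  abel

/-! ## §3 The transverse two-point blocks of `𝒞` are the canonical ones -/

/-- **`T·𝒞·Tᴴ = T·critCov (½∂ᴴ∂) Q·Tᴴ` FOR EVERY TEST MATRIX WITH CO-CLOSED ROWS** (`T·∂ = 0`, `∂ = GradOp`): the transverse two-point blocks of
Bałaban's gauge-fixed constrained covariance equal those of the canonical (gauge-free) constrained covariance of road P4 — slice independence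
(`MonotoneCritical.pairing_eq_critCov`) applied to §2. [folklore] -/
theorem transverse_block_Cov_eq_critCov {τ : Type*} [Fintype τ] [DecidableEq τ] (T : Matrix τ (Tor (fine n M) × Fin d) ℂ)
    (hT : T * GradOp (fine n M) (n : ℂ) = 0) :
    T * Cov n hn M a ha * Tᴴ = T * critCov (curlForm_isHermitian n M) (QvOp n M) * Tᴴ := by
  have h1 : (T * Cov n hn M a ha * Tᴴ).IsHermitian := Matrix.isHermitian_mul_mul_conjTranspose _ (Cov_conjTranspose n hn M a ha)
  have h2 : (T * critCov (curlForm_isHermitian n M) (QvOp n M) * Tᴴ).IsHermitian :=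
    Matrix.isHermitian_mul_mul_conjTranspose _ (critCov_isHermitian _ _)
  refine hermitian_ext_of_quad h1 h2 fun u => ?_
  rw [readOut_quad, readOut_quad]
  have hr : (GradOp (fine n M) (n : ℂ))ᴴ *ᵥ (Tᴴ *ᵥ u) = 0 := by
    rw [Matrix.mulVec_mulVec, ← Matrix.conjTranspose_mul, hT, Matrix.conjTranspose_zero, Matrix.zero_mulVec]
  exact pairing_eq_critCov (curlForm_posSemidef n M) (QvOp n M) (isCrit_Cov_of_coclosed n hn M a ha _ hr)

/-- **`∂·𝒞·∂ᴴ = ∂·critCov (½∂ᴴ∂) Q·∂ᴴ`** (`∂ = CurlOp`; `CurlOp · GradOp = 0`): the PLAQUETTE two-point function of Bałaban's gauge-fixed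
constrained fluctuation field (tree `FluctuationProjection.Cov`) IS the canonical one — the object of road P4's Loewner theorems
(`MonotoneTorusPlaquette`, `MonotoneTorusEffective`, `MonotoneTorusSoft`). [folklore] -/
theorem curl_block_Cov_eq_critCov :
    CurlOp (fine n M) (n : ℂ) * Cov n hn M a ha * (CurlOp (fine n M) (n : ℂ))ᴴ
      = CurlOp (fine n M) (n : ℂ) * critCov (curlForm_isHermitian n M) (QvOp n M) * (CurlOp (fine n M) (n : ℂ))ᴴ :=
  transverse_block_Cov_eq_critCov n hn M a ha _ (CurlOp_mul_GradOp (fine n M) (n : ℂ))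

/-- The pairing form: for every co-closed source `r`, `⟨r, 𝒞 r⟩ = ⟨r, critCov (½∂ᴴ∂) Q r⟩` (the variance of every transverse observable of the
gauge-fixed constrained field is the canonical one). [folklore] -/
theorem pairing_Cov_eq_critCov (r : Tor (fine n M) × Fin d → ℂ) (hr : (GradOp (fine n M) (n : ℂ))ᴴ *ᵥ r = 0) :
    star r ⬝ᵥ (Cov n hn M a ha *ᵥ r) = star r ⬝ᵥ (critCov (curlForm_isHermitian n M) (QvOp n M) *ᵥ r) :=
  pairing_eq_critCov (curlForm_posSemidef n M) (QvOp n M) (isCrit_Cov_of_coclosed n hn M a ha r hr)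

/-! ## §4 (v1.1, append-only) The common generalisation of §1 and of the printed (1.95); curl sources are co-closed

DOCFIX conceded to the cross-read C-gan24leaf14-29 (leaf-14-g27): §1 and an5's (1.95) `R_div_G_QvAdj_mulVec` are the two instances `g = 0` and
`g = n^d·∂₁ᴴω` of ONE statement about sources whose divergence is a `Q′ᴴ`-image of a mean-zero coarse scalar field.  The proof below is §1's,
with the right-hand side `Q′ᴴ g` carried along (proof text adapted from the reader's scratch probe `ProbeMonotoneTorusLandau.lean`, P1). -/

/-- **UNIFIED MECHANISM** `∂ᴴ r = Q′ᴴ g ∧ Σ g = 0 ⟹ R ∂ᴴ (G r) = 0`: if the divergence of the source is a `Q′ᴴ`-image of a MEAN-ZERO coarse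
field, the Landau multiplier of `A = G r` vanishes.  §1 is `g = 0`; the printed (1.95) (`r = Q*ω`) is `g = n^d·∂₁ᴴω` (by `GradOp_adjoint_mul_QvAdj`,
the adjoint of (1.55)). [folklore] -/
theorem R_div_G_mulVec_of_div_eq (r : Tor (fine n M) × Fin d → ℂ) (g : Tor M → ℂ) (hg : ∑ y, g y = 0)
    (hr : (GradOp (fine n M) (n : ℂ))ᴴ *ᵥ r = (QsOp n M)ᴴ *ᵥ g) :
    (1 - PcT n M (n : ℂ)) *ᵥ ((GradOp (fine n M) (n : ℂ))ᴴ *ᵥ (calG n hn M a ha *ᵥ r)) = 0 := by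
  obtain ⟨A, hA⟩ : ∃ A, A = calG n hn M a ha *ᵥ r := ⟨_, rfl⟩
  rw [← hA]
  have hDA : DeltaA n M a *ᵥ A = r := by
    rw [hA, Matrix.mulVec_mulVec, DeltaA_mul_calG n hn M a ha, Matrix.one_mulVec]
  obtain ⟨u, hu⟩ : ∃ u, u = (1 - PcT n M (n : ℂ)) *ᵥ ((GradOp (fine n M) (n : ℂ))ᴴ *ᵥ A) := ⟨_, rfl⟩
  rw [← hu]
  -- (i) `u ⊥ 1`
  have hu0 : ∑ x, u x = 0 := by
    rw [hu]
    simp only [Matrix.sub_mulVec, Matrix.one_mulVec, Pi.sub_apply, Finset.sum_sub_distrib, sum_GradOp_adjoint, sum_PcT_mulVec,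
      sub_zero]
  -- (ii) `∂ᴴ Δ_a A = ∂ᴴ r = Q′ᴴ g`, expanded with `∂ᴴΔ_a = Δ_s R ∂ᴴ + a ∂ᴴQ*Q` and `∂ᴴQ* = n^d Q′ᴴ∂₁ᴴ`
  have key : ((GradOp (fine n M) (n : ℂ))ᴴ * DeltaA n M a) *ᵥ A = (QsOp n M)ᴴ *ᵥ g := by
    rw [← Matrix.mulVec_mulVec, hDA, hr]
  rw [GradOp_adjoint_mul_DeltaA n M a, GradOp_adjoint_mul_QvAdj] at key
  simp only [Matrix.add_mulVec, Matrix.smul_mulVec, Matrix.smul_mul, ← Matrix.mulVec_mulVec] at key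
  -- key : Δ_s(R∂ᴴA) + a • n^d • Q′ᴴ(∂₁ᴴ(QA)) = Q′ᴴ g
  have hL : LapS (fine n M) (n : ℂ) *ᵥ u
      = (QsOp n M)ᴴ *ᵥ (g - (GradOp M 1)ᴴ *ᵥ ((a : ℂ) • (((n : ℂ) ^ d) • (QvOp n M *ᵥ A)))) := by
    rw [hu, Matrix.mulVec_sub]
    simp only [Matrix.mulVec_smul]
    exact eq_sub_of_add_eq key
  have hg' : ∑ y, (g - (GradOp M 1)ᴴ *ᵥ ((a : ℂ) • (((n : ℂ) ^ d) • (QvOp n M *ᵥ A)))) y = 0 := by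
    simp only [Pi.sub_apply, Finset.sum_sub_distrib, hg, sum_GradOp_adjoint M 1 _, sub_zero]
  -- (iii) `P u = u`; (iv) `P u = P(1 − P)(∂ᴴA) = 0`
  have hP := PcT_eq_self_of_LapS_eq n M u _ hu0 hg' hL
  have hP0 : PcT n M (n : ℂ) *ᵥ u = 0 := by rw [hu, PcT_one_sub_PcT_mulVec]
  rw [← hP, hP0]

/-- **EVERY CURL-TYPE SOURCE IS CO-CLOSED**: `∂_gradᴴ (∂_curlᴴ u) = 0` (adjoint of `CurlOp · GradOp = 0`) — so §§1–3 apply to every plaquette-supported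
source, the case the header advertises. [folklore] -/
theorem coclosed_curl_adjoint (u : Tor (fine n M) × (Fin d × Fin d) → ℂ) :
    (GradOp (fine n M) (n : ℂ))ᴴ *ᵥ ((CurlOp (fine n M) (n : ℂ))ᴴ *ᵥ u) = 0 := by
  rw [Matrix.mulVec_mulVec, ← Matrix.conjTranspose_mul, CurlOp_mul_GradOp, Matrix.conjTranspose_zero, Matrix.zero_mulVec]

/-- **The column of Bałaban's `𝒞` at every plaquette-supported source `∂_curlᴴ u` is critical for `½∂ᴴ∂` on `ker Q`** (§2 at a curl source). [folklore] -/
theorem isCrit_Cov_curl_adjoint (u : Tor (fine n M) × (Fin d × Fin d) → ℂ) :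
    IsCrit (curlForm n M) ((CurlOp (fine n M) (n : ℂ))ᴴ *ᵥ u) (LinearMap.ker (QvOp n M).mulVecLin)
      (Cov n hn M a ha *ᵥ ((CurlOp (fine n M) (n : ℂ))ᴴ *ᵥ u)) :=
  isCrit_Cov_of_coclosed n hn M a ha _ (coclosed_curl_adjoint n M u)

end Summit.QuantumFields.BalabanUV.Beta.GAN24.MonotoneTorusLandau
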